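import Literature.IUT.HodgeTheaters.PiAvatarLocalHoms
import Literature.IUT.HodgeTheaters.PiAvatarNFSide
import HarnessLib

/-!
# J-NF-1: the NF-widened objects in play `InPlayNF` / ambient `AmbNF` of a local datum — the isomorphs of `𝒟^⊚ = ℬ(Π_{C̲_K})⁰` join the
# objects in play so that [IUTchI] Def 4.1 (vi) `φ^NF_{•,v} : †𝒟_v → †𝒟^⊚` types in the kit's ambient; the extra branch is VACUOUS for the
# `Θ`-side slots (small defs + proofs — post-freeze additive D13, not a cone member)

S. Mochizuki, *Inter-universal Teichmüller theory I*, kurims manuscript (May 2020), Def 4.1 (v) p. 97 («`†𝒟^⊚` … a category equivalent to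
`𝒟^⊚`»), (vi) p. 97 («we define a poly-morphism `†𝒟_v → †𝒟^⊚` to be a collection of morphisms `†𝒟_v → †𝒟^⊚`»), Ex 4.3 (ii) p. 99 («the natural
morphism `φ^NF_{•,v} : 𝒟_v → 𝒟^⊚`»), Def 6.1 (v) p. 158 («a finite étale double covering `𝒟^{⊚±} → 𝒟^⊚ = ℬ(C_K)⁰`»), (vii) p. 159 (morphisms
`†𝒟_v → †𝒟^{⊚±}` live in one ambient) ([IUTchI] Def 4.1 (vi) p.97) [claim: Mochizuki2012, status: disputed] (D-0012 claim key, series status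
DISPUTED — definitions and kernel theorems over abc-iut-L5-t2's REAL `InitialThetaData`, abc-iut-L5-t1's `CuspGalois`, abc-iut-L5-t4's binder
`hS : D.CuspClassesNormaliserStable` and local datum `δ : D.LocalDatum CG hS` (p442681); nothing of the series is asserted, no side is taken on
[IUTchIII] Cor. 3.12).

WHY (abc-iut-L5-lead RULINGS #67 (3) / #70 (7), junction J-NF-1 raised by abc-iut-L5-t3 g6).  abc-iut-L5-t4's genuine base kit (p444202/p445979)
reads `Amb v := (δ v).Amb`, the full subcategory of the Π-ambient on `(δ v).InPlay` = isomorphs of `𝒟_v̲`, of `†𝒟_v̲^±`, of `𝒟^{⊚±}` — the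
objects Def 6.1 puts in play.  abc-iut-L5-t3's NF-side kit `PMBaseKit.NFKit K` (KitNFSide) needs `nfAtV x : GlobNF ⥤ K.Amb x`: the isomorphs
`†𝒟^⊚` of `𝒟^⊚ = ℬ(Π_{C̲_K})⁰` SEEN AT `v`, as objects of the SAME ambient (Def 4.1 (vi): `φ^NF_{•,v}` is a morphism `†𝒟_v → †𝒟^⊚`).  This file
WIDENS the objects in play by that one disjunct — **`LocalDatum.InPlayNF X := δ.InPlay X ∨ D.IsGlobNFIsomorph X`**, **`AmbNF := InPlayNF.FullSubcategory`**
— ADDITIVELY (PiAvatarLocalAmbient/LocalHoms/BaseKit untouched), and proves that the new branch is DISJOINT from the three old ones and carries NO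
morphism to a global isomorph: **`isEmpty_hom_of_isGlobNFIsomorph`** — `Hom(isomorph of 𝒟^⊚, isomorph of 𝒟^{⊚±}) = ∅` from the local arrow law
(L1) of `δ` (`Π_v̲ ≤ Π_{X̲_K} ≤ Π_{C̲_K}`) and its negative element (`Π_{X̲_K} ≠ Π_{C̲_K}`); **`not_inPlay_of_isGlobNFIsomorph`**.  Hence abc-iut-L5-t4's
kit law `labOfHom_post`, the only slot law quantifying over sources in play, transfers verbatim: **`labOfHomAmb_post_of_inPlayNF`**.  The
re-typed kit `baseKitNF…` over `(δ v).AmbNF` (Θ-side slot values `modelNF`/`atVNF`/`phiEllNF`/`pmPairNF`) is abc-iut-L5-t4's NEW module; the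
NF-side slots `nfAtVNF`/`projAtNF` and the assembly `nfKit` are abc-iut-L5-t3's row «nfKit-assembly».  «J-NF-1: ambient widened by the
𝒟^⊚-isomorph disjunct so that Def 4.1 (vi) φ^NF_{•,v̲} types; Θ-side kit unchanged.»  No instance, no notation; typed ≠ proved elsewhere.
-/

noncomputable section

namespace Literature.IUT.HodgeTheaters

open CategoryTheory

universe u v w

section LocalAmbientNF

variable {F : Type u} {K : Type v} {Fbar : Type w} [Field F] [NumberField F] [Field K] [NumberField K]
  [Algebra F K] [Field Fbar] [Algebra F Fbar] [Algebra K Fbar]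
  {E : WeierstrassCurve F} [E.IsElliptic] {l : ℕ} {Pb : BadPlacePredicates K}
  {D : InitialThetaData F K Fbar E l Pb} {CG : D.geom.pe.CuspGalois} {hS : D.CuspClassesNormaliserStable} [Fact l.Prime]
  (δ : D.LocalDatum CG hS)

namespace InitialThetaData

namespace LocalDatum

/-! ### The NF-widened objects in play -/

/-- **The NF-widened objects in play at `v̲`**: the objects in play of abc-iut-L5-t4 (isomorphs of `𝒟_v̲`, of `†𝒟_v̲^±`, of `𝒟^{⊚±}`) OR an
isomorph `†𝒟^⊚` of `𝒟^⊚ = ℬ(Π_{C̲_K})⁰` (Def 4.1 (v); abc-iut-L5-t3's `IsGlobNFIsomorph`) — so that the morphisms `†𝒟_v → †𝒟^⊚` of Def 4.1 (vi)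
are morphisms of the kit's ambient («J-NF-1»). ([IUTchI] Def 4.1 (vi) p.97) [claim: Mochizuki2012, status: disputed] -/
def InPlayNF : ObjectProperty D.PiAmbient := fun X => δ.InPlay X ∨ D.IsGlobNFIsomorph X

/-- `InPlayNF X ↔ InPlay X ∨ IsGlobNFIsomorph X` (definitional). ([IUTchI] Def 4.1 (vi) p.97) [claim: Mochizuki2012, status: disputed] -/
theorem inPlayNF_iff (X : D.PiAmbient) : δ.InPlayNF X ↔ δ.InPlay X ∨ D.IsGlobNFIsomorph X := Iff.rfl

/-- **Kit slot `Amb v` (NF-widened)**: the full subcategory of the Π-ambient on the NF-widened objects in play.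
([IUTchI] Def 6.1 (vii) p.159) [claim: Mochizuki2012, status: disputed] -/
abbrev AmbNF : Type w := (δ.InPlayNF).FullSubcategory

/-- The old objects in play are in play. ([IUTchI] Def 6.1 (vii) p.159) [claim: Mochizuki2012, status: disputed] -/
theorem inPlay_le_inPlayNF : δ.InPlay ≤ δ.InPlayNF := fun _ h => Or.inl h

/-- The isomorphs of `𝒟^⊚` are in play. ([IUTchI] Def 4.1 (v) p.97) [claim: Mochizuki2012, status: disputed] -/
theorem isGlobNFIsomorph_le_inPlayNF : D.IsGlobNFIsomorph ≤ δ.InPlayNF := fun _ h => Or.inr h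

/-- The isomorphs of `𝒟^{⊚±}` are in play. ([IUTchI] Def 6.1 (vii) p.159) [claim: Mochizuki2012, status: disputed] -/
theorem isGlobIsomorph_le_inPlayNF : D.IsGlobIsomorph ≤ δ.InPlayNF := δ.isGlobIsomorph_le_inPlay.trans δ.inPlay_le_inPlayNF

/-! ### No conjugate of `Π_{C̲_K}` lies in `Π_{X̲_K}` (from (L1) and the negative element) -/

/-- `Π_v̲ ≤ Π_{C̲_K}`. ([IUTchI] Def 3.1 (f) p.63) [claim: Mochizuki2012, status: disputed] -/
theorem H_le_PiCund : δ.H ≤ D.PiCund := (δ.le_und.trans δ.und_le).trans D.PiXund_le_PiCund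

/-- **No element of `Π_{C_F}` conjugates `Π_{C̲_K}` into `Π_{X̲_K}`**: such an `e` would conjugate `Π_v̲ ≤ Π_{C̲_K}` into `Π_{X̲_K}`, hence normalise
`Π_{X̲_K}` by (L1), and then the negative element `c ∈ Π_{C̲_K} ∖ Π_{X̲_K}` of the datum (Def 6.1 (v): `𝒟^{⊚±} → 𝒟^⊚` is a genuine double covering)
would lie in `Π_{X̲_K}`. ([IUTchI] Def 6.1 (v) p.158) [claim: Mochizuki2012, status: disputed] -/
theorem not_conj_PiCund_le_PiXund (δ : D.LocalDatum CG hS) (e : D.PiC) (h : ∀ y ∈ D.PiCund, e⁻¹ * y * e ∈ D.PiXund) : False := by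
  have hN : e ∈ Subgroup.normalizer ((D.PiXund : Subgroup D.PiC) : Set D.PiC) :=
    δ.law.mem_normalizer_of_conj_le e fun x hx => h x (δ.H_le_PiCund hx)
  obtain ⟨c, -, hc, hcX⟩ := δ.exists_neg
  apply hcX
  have h1 := (Subgroup.mem_normalizer_iff.mp hN (e⁻¹ * c * e)).mp (h c hc)
  have e1 : e * (e⁻¹ * c * e) * e⁻¹ = c := by group
  rwa [e1] at h1

/-! ### The isomorphs of `𝒟^⊚` form a FOURTH, disjoint branch -/

/-- An isomorph of `𝒟^⊚` is not an isomorph of `𝒟_v̲`. ([IUTchI] Def 4.1 (v) p.97) [claim: Mochizuki2012, status: disputed] -/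
theorem not_nonempty_iso_locObj_of_isGlobNFIsomorph {X : D.PiAmbient} (hX : D.IsGlobNFIsomorph X) : ¬ Nonempty (X ≅ δ.locObj) := by
  rintro ⟨i⟩
  obtain ⟨a, ha⟩ := (OrbitCat.nonempty_iso_iff_conjugate δ.H D.PiCund).mp ⟨i.symm ≪≫ hX.some⟩
  refine δ.not_conj_PiCund_le_PiXund a⁻¹ fun y hy => ?_
  rw [inv_inv]
  exact (δ.le_und.trans δ.und_le) ((ha y).mp hy)

/-- An isomorph of `𝒟^⊚` is not an isomorph of `†𝒟_v̲^±`. ([IUTchI] Def 6.1 (ii) p.156) [claim: Mochizuki2012, status: disputed] -/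
theorem not_nonempty_iso_undObj_of_isGlobNFIsomorph {X : D.PiAmbient} (hX : D.IsGlobNFIsomorph X) : ¬ Nonempty (X ≅ δ.undObj) := by
  rintro ⟨i⟩
  obtain ⟨a, ha⟩ := (OrbitCat.nonempty_iso_iff_conjugate δ.Hund D.PiCund).mp ⟨i.symm ≪≫ hX.some⟩
  refine δ.not_conj_PiCund_le_PiXund a⁻¹ fun y hy => ?_
  rw [inv_inv]
  exact δ.und_le ((ha y).mp hy)

/-- An isomorph of `𝒟^⊚` is not an isomorph of `𝒟^{⊚±}` (the double covering `𝒟^{⊚±} → 𝒟^⊚` is not an isomorphism).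
([IUTchI] Def 6.1 (v) p.158) [claim: Mochizuki2012, status: disputed] -/
theorem not_nonempty_iso_gModelObj_of_isGlobNFIsomorph (δ : D.LocalDatum CG hS) {X : D.PiAmbient} (hX : D.IsGlobNFIsomorph X) : ¬ Nonempty (X ≅ D.gModelObj) := by
  rintro ⟨i⟩
  obtain ⟨a, ha⟩ := (OrbitCat.nonempty_iso_iff_conjugate D.PiXund D.PiCund).mp ⟨i.symm ≪≫ hX.some⟩
  refine δ.not_conj_PiCund_le_PiXund a⁻¹ fun y hy => ?_
  rw [inv_inv]
  exact (ha y).mp hy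

/-- **The four branches are disjoint**: an isomorph of `𝒟^⊚` is not among abc-iut-L5-t4's objects in play.
([IUTchI] Def 4.1 (v) p.97) [claim: Mochizuki2012, status: disputed] -/
theorem not_inPlay_of_isGlobNFIsomorph {X : D.PiAmbient} (hX : D.IsGlobNFIsomorph X) : ¬ δ.InPlay X := fun h =>
  h.elim (δ.not_nonempty_iso_locObj_of_isGlobNFIsomorph hX) fun h' =>
    h'.elim (δ.not_nonempty_iso_undObj_of_isGlobNFIsomorph hX) (δ.not_nonempty_iso_gModelObj_of_isGlobNFIsomorph hX)

/-- **`Hom(†𝒟^⊚, †𝒟^{⊚±}) = ∅` in the Π-ambient**: a morphism `ℬ(aΠ_{C̲_K}a⁻¹)⁰ → ℬ(bΠ_{X̲_K}b⁻¹)⁰` would conjugate `Π_{C̲_K}` into `Π_{X̲_K}`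
(the double covering `𝒟^{⊚±} → 𝒟^⊚` has no section, Def 6.1 (v)). ([IUTchI] Def 6.1 (v) p.158) [claim: Mochizuki2012, status: disputed] -/
theorem isEmpty_hom_of_isGlobNFIsomorph (δ : D.LocalDatum CG hS) {X : D.PiAmbient} (hX : D.IsGlobNFIsomorph X) (G : D.Glob) : IsEmpty (X ⟶ G.obj) := by
  refine ⟨fun f => ?_⟩
  obtain ⟨a, ha⟩ := (OrbitCat.nonempty_iso_iff_conjugate X.sub D.PiCund).mp hX
  obtain ⟨b, hb⟩ := (OrbitCat.nonempty_iso_iff_conjugate (G.obj).sub D.PiXund).mp G.property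
  obtain ⟨d, hd, -⟩ := OrbitCat.exists_eq_homOfElem (H := X.sub) (K := (G.obj).sub) f
  refine δ.not_conj_PiCund_le_PiXund (a⁻¹ * d * b) fun y hy => ?_
  have h1 : d⁻¹ * (a * y * a⁻¹) * d ∈ (G.obj).sub := hd _ ((ha y).mp hy)
  have e1 : b * (b⁻¹ * (d⁻¹ * (a * y * a⁻¹) * d) * b) * b⁻¹ = d⁻¹ * (a * y * a⁻¹) * d := by group
  have h2 : b⁻¹ * (d⁻¹ * (a * y * a⁻¹) * d) * b ∈ D.PiXund := (hb _).mpr (by rw [e1]; exact h1)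
  have e2 : (a⁻¹ * d * b)⁻¹ * y * (a⁻¹ * d * b) = b⁻¹ * (d⁻¹ * (a * y * a⁻¹) * d) * b := by group
  rw [e2]
  exact h2

/-! ### abc-iut-L5-t4's kit law `labOfHom_post` on the NF-widened objects in play -/

/-- **Kit law `labOfHom_post` for sources in play in the NF-widened sense** — abc-iut-L5-t4's `labOfHomAmb_post` on the three old branches,
VACUOUS on the isomorphs of `𝒟^⊚` (no morphism to a global isomorph). ([IUTchI] Prop 6.5 (i) p.163) [claim: Mochizuki2012, status: disputed] -/
theorem labOfHomAmb_post_of_inPlayNF {X : D.PiAmbient} (hXP : δ.InPlayNF X) {G G' : D.Glob} (f : X ⟶ G.obj) (ψ : G ≅ G') :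
    δ.labOfHomAmb (f ≫ ψ.hom.hom) = ⇑(D.gLabIso CG hS ψ) ∘ δ.labOfHomAmb f := by
  rcases hXP with h | h
  · exact δ.labOfHomAmb_post h f ψ
  · exact ((δ.isEmpty_hom_of_isGlobNFIsomorph h G).false f).elim

end LocalDatum

end InitialThetaData

end LocalAmbientNF

end Literature.IUT.HodgeTheaters
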